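import Summits.CriticalPhenomena.CardyFormulaZ2.Theorems.CardyComplexConeCoherentMorera
import Summits.CriticalPhenomena.CardyFormulaZ2.Theses.CardySusyWard

/-!
# Cross-route implication: `CardyComplexCone.EdgeCoherence → CardySusyWard.WeakHolomorphy`

The crux `CardySusyWard.WeakHolomorphy` (stmt-CriticalPhenomena-11292, the weak dual half of discrete
Cauchy–Riemann for the `q = 1`, spin-`1/3` parafermion) follows from the sibling route's rank-2 crux
`CardyComplexCone.EdgeCoherence` (stmt-CriticalPhenomena-11385) ALONE, by the landed stubs of the proved
sibling crux `CoherentMorera` (stmt-CriticalPhenomena-11388: `stub_pairingBound`, `stub_kirchhoff`,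
`stub_traceIdentity`, `stub_siteRegrouping`, `stub_coherenceShift`, `stub_modeSelection`;
`EdgePrecompact` enters only CoherentMorera's second clause and is not used).  Written by the crux
strategist `planner-cstrat-stmt-CriticalPhenomena-11292-p1-0` (`Cruxes/WeakHolomorphy/CrossRoute.lean`,
STRATEGY-CENSUS §6 D3) and landed by the line lead as infrastructure: the two routes' rank-2 cruxes are
ONE open statement up to EdgeCoherence's extra odd-harmonic clause.
Reference: Duminil-Copin–Smirnov, arXiv:1109.1549, §8.3 (Conj. 8.7).
-/

noncomputable section

namespace Summit.CriticalPhenomena.CardyFormulaZ2.Theorems.WeakHolomorphy.CrossRoute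

open scoped BigOperators Topology
open Filter Set MeasureTheory
open _root_.Literature.Probability.LatticeModels
open _root_.Literature.Probability.RandomPlanarGeometry (DobrushinDomain)
open Summit.CriticalPhenomena.CardyFormulaZ2.Cruxes.CoherentMorera.FinitaryGreenPairing
open Summit.CriticalPhenomena.CardyFormulaZ2.Theses.CardyComplexCone (EdgeCoherence)
open Summit.CriticalPhenomena.CardyFormulaZ2.Theses.CardySusyWard (WeakHolomorphy)

/-- **Cross-route implication.** `EdgeCoherence → WeakHolomorphy` (the three Hausdorff hypotheses of
the family form are simply not used).  CONDITIONAL on the open sibling crux; credits nothing by itself.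
[cite: DuminilCopinSmirnov2012Lattice, Conjecture 8.7] -/
theorem stub_weakHolomorphyOfEdgeCoherence : EdgeCoherence → WeakHolomorphy := by
  intro hC D Λ hΩ hδ _hA _hB _hab hadm φ hφ hsupp hsub
  have hG : Guards D Λ := ⟨hΩ, hδ, hadm⟩
  have hT : TestFn D φ := ⟨hφ, hsupp, hsub⟩
  obtain ⟨u, hu0, hu⟩ := hC
  have h0 : ScaledNull (P0 Λ φ) :=
    scaledNull_of_sub_of_or (spinShift_of stub_pairingBound stub_kirchhoff D Λ hG φ hT)
      (stub_modeSelection u hu0 hu (stub_coherenceShift u hu) D Λ hG φ hT)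
  exact (stub_siteRegrouping D Λ hG (stub_traceIdentity D Λ hG) φ hT).2 h0

end Summit.CriticalPhenomena.CardyFormulaZ2.Theorems.WeakHolomorphy.CrossRoute

end
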